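import Summits.QuantumFields.YangMills.Theorems.BalabanUVNodesN17RunWindowShiftTransportToy

/-!
# NODE N17 (NE4) — FILE 11: CRIT-2's MARGINAL-TRANSPORT TOY ALSO SATISFIES FILE 6's INFRARED-MATCHED TWO-RUN LETTER (TR) WITH A SUMMABLE `≍ 1∕k²` MODULUS — so FILE 6's two-run lever,
# like FILE 5's run-window lever (FILE 8), has a NON-FLAT first-entry-only inhabitant; the two-run keying survives the caricature WITHOUT an exact transport reading (the toy's transport rate
# `c` is free), while its box letter fails at every geometric rate (FILE 7)

Cell `pub-ymgap`, YM-PLAN Track A (HUMAN RULINGS D-0062 ∕ D-0149), WIDTH SEAT `pub-ymgap-dag-n17-w1` (generation 6), CLAIM-6 ∕ INTENT-6.  Key K3⁸ stmt-QuantumFields-27366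
`SpineGivenEndpointR13SepCoPHV` (`--kind proof --supports stmt-QuantumFields-27366 --as helper`, COUNT-NEUTRAL).  Imports FILE 8 p632507 `…N17RunWindowShiftTransportToy` (the toy as a
hypothesis text `hβ : ∀ k p, β k p = β₀ + α (p 0)²∕(1 + c k (p 0)²)`, its run recursion `inv_sq_succ_of_toyRun`, `scaleAnchor_toy`, `endRuns_toy`), hence FILE 6 p627997 `…N17TwoRunShift`.

THE COMPUTATION (elementary; toy over a generic β, NOT Bałaban's β).  For an IR-matched pair of in-window toy runs — B = `gs` (`k+1` steps), A = `hs` (`k` steps), `hs k = gs (k+1)` — with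
bare couplings `x_B = gs 0`, `x_A = hs 0`, `u := x²`: (TR)_k `= |F_{k+1}(x_B) − F_k(x_A)| = α·|1∕u_A − 1∕u_B − c| ∕ ((1∕u_B + c(k+1))(1∕u_A + ck))` (§1 `toyTwoRunShift_eq`); the pin and
the two telescoped recursions give `1∕u_A − 1∕u_B = −F_k(x_B) − Σ_{i<k}(F_i(x_B) − F_i(x_A))` (§1 `inv_sq_bare_sub_eq_of_pin`), and `F_i(x_B) − F_i(x_A) = α(u_B − u_A)∕((1+ciu_B)(1+ciu_A))`
with `u_B − u_A = u_A u_B (1∕u_A − 1∕u_B)`; the sum `Σ_{i<k} u_A u_B∕((1+ciu_A)(1+ciu_B)) ≤ Σ_{i<k} w²∕(1+ciw)² ≤ w² + w∕c ≤ γ⁴ + γ²∕c` (`w := max u_A u_B ≤ γ²`; monotonicity of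
`u ↦ u∕(1+tu)` and the telescope `w²∕(1+c(j+1)w)² ≤ (w∕c)(1∕(1+cjw) − 1∕(1+c(j+1)w))`, §1 `sum_sq_div_sq_le`); so under the window `α(γ⁴ + γ²∕c) ≤ ½` the bare discrepancy obeys
`|1∕u_A − 1∕u_B| ≤ 2(β₀ + αγ²)` (§2 `abs_inv_sq_bare_sub_le`) and ★ `twoRunShift_toy`: (TR)_k `≤ α(2(β₀+αγ²) + c)∕(m²(k+1)²)`, `m := min c (1∕γ²)` — SUMMABLE (FILE 8's `summable_toyModulus`).
★★ `exists_runConstRemainder_toy_twoRun`: FILE 6's ★ BY NAME (anchor `scaleAnchor_toy`, (ER) `endRuns_toy`, corner step 0) — the same conclusion as FILE 8's ★★, now through the two-run lever.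
HONEST SCOPE (A6).  A toy over a GENERIC `β : HBeta`; nothing of Bałaban asserted or instantiated; whether NODE 00's record is first-entry-only ∕ transport-read is node00-def ∕ def-T's
desk; NE4 NOT IN PRINT ([Balaban1987RG1] p. 264) and NOT proved in any keying; NOT a proof of any K3⁸ ∕ K1⁹ stub; N17 NOT discharged (DEPENDENT∕DERIVED row); K0⁷ ∕ K1⁹ ∕ K3⁸ OPEN; counts
UNMOVED (typed 28∕28 · discharged 5∕27 · A 5∕28).  One finite four-torus programme at fixed `ε = L^{−K}`; the YM mass gap (Clay) is NOT proved by any of this — R4 closes the conditional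
finite-𝕋⁴ rung `BalabanLadder.UV` only; nothing continuum ∕ ℝ⁴ ∕ OS.
[I] = [Balaban1987RG1] T. Bałaban, CMP **109** (1987): (0.20) p. 256, Thm 2 p. 259, (1.20)–(1.22) p. 264, (2.12)–(2.14) p. 268.
-/

noncomputable section

namespace Summit.QuantumFields.YangMills.BalabanUVNodes.N17TwoRunShiftTransportToy

open Literature.MathematicalPhysics.QuantumFieldTheory.Balaban1983to89
open Literature.MathematicalPhysics.QuantumFieldTheory.Balaban1983to89.FlowStep
open Summit.QuantumFields.YangMills.Theorems.BalabanUVNodesK2NamedJetsRunRemAt (RunConstRemainder)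
open Summit.QuantumFields.YangMills.BalabanUVNodes.N17TwoRunShift (exists_runConstRemainder_of_twoRunShift_cornerStep_scaleAnchor_endRuns)
open Summit.QuantumFields.YangMills.BalabanUVNodes.N17RunWindowShiftTransportToy (inv_sq_succ_of_toyRun summable_toyModulus scaleAnchor_toy endRuns_toy)
open Finset

variable {β : HBeta} {β₀ α c γ : ℝ}

/-! ## §1 Algebra of the toy along two runs -/

/-- TELESCOPED TOY RECURSION: along an in-window toy run, `1∕g_n² = 1∕g_0² − Σ_{i<n}(β₀ + α g_0²∕(1 + cig_0²))`. [cite: Balaban1987RG1, (0.20) p.256] -/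
theorem inv_sq_eq_sub_sum_of_toyRun (hβ : ∀ (k : ℕ) (p : Fin (k + 1) → ℝ), β k p = β₀ + α * (p 0) ^ 2 / (1 + c * k * (p 0) ^ 2))
    {n : ℕ} {gs : ℕ → ℝ} (hrg : RGEqH n β gs) :
    ∀ m, m ≤ n → 1 / gs m ^ 2 = 1 / gs 0 ^ 2 - ∑ i ∈ range m, (β₀ + α * (gs 0) ^ 2 / (1 + c * i * (gs 0) ^ 2)) := by
  intro m
  induction m with
  | zero => intro _; simp
  | succ m ih =>
    intro hm
    rw [inv_sq_succ_of_toyRun hβ hrg (i := m) (by omega), ih (by omega), Finset.sum_range_succ]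
    ring

/-- **THE BARE DISCREPANCY OF AN IR-MATCHED PAIR, EXACTLY**: for toy runs B = `gs` (`k+1` steps) and A = `hs` (`k` steps) with `hs k = gs (k+1)`:
`1∕(hs 0)² − 1∕(gs 0)² = −F_k(gs 0) − Σ_{i<k}(F_i(gs 0) − F_i(hs 0))`, `F_i(x) := β₀ + αx²∕(1+cix²)`. [cite: Balaban1987RG1, (0.20) p.256 and Thm 2 p.259] -/
theorem inv_sq_bare_sub_eq_of_pin (hβ : ∀ (k : ℕ) (p : Fin (k + 1) → ℝ), β k p = β₀ + α * (p 0) ^ 2 / (1 + c * k * (p 0) ^ 2))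
    {k : ℕ} {gs hs : ℕ → ℝ} (hg : RGEqH (k + 1) β gs) (hh : RGEqH k β hs) (hend : hs k = gs (k + 1)) :
    1 / hs 0 ^ 2 - 1 / gs 0 ^ 2
      = -(β₀ + α * (gs 0) ^ 2 / (1 + c * k * (gs 0) ^ 2))
        - ∑ i ∈ range k, ((β₀ + α * (gs 0) ^ 2 / (1 + c * i * (gs 0) ^ 2)) - (β₀ + α * (hs 0) ^ 2 / (1 + c * i * (hs 0) ^ 2))) := by
  have hB := inv_sq_eq_sub_sum_of_toyRun hβ hg (k + 1) le_rfl
  have hA := inv_sq_eq_sub_sum_of_toyRun hβ hh k le_rfl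
  have hpin : 1 / hs k ^ 2 = 1 / gs (k + 1) ^ 2 := by rw [hend]
  rw [hA, hB, Finset.sum_range_succ] at hpin
  rw [Finset.sum_sub_distrib]
  linarith

/-- Monotonicity of the transport factor in the coupling: `0 ≤ t`, `0 ≤ u ≤ w` ⟹ `u∕(1+tu) ≤ w∕(1+tw)` (the same elementary fact as
`Summit.CriticalPhenomena.PercolationContinuityZ3.Theorems.TransplantSharpness.Ray.div_one_add_mul_mono` of another summit's tree — cited, not importable across summits). [folklore] -/
theorem transportFactor_mono {t u w : ℝ} (ht : 0 ≤ t) (hu : 0 ≤ u) (huw : u ≤ w) : u / (1 + t * u) ≤ w / (1 + t * w) := by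
  have h1 : 0 < 1 + t * u := by positivity
  have h2 : 0 < 1 + t * w := by have := mul_nonneg ht (hu.trans huw); linarith
  rw [div_le_div_iff₀ h1 h2]
  nlinarith [mul_nonneg ht hu]

/-- THE TELESCOPE: for `c > 0`, `w ≥ 0`: `Σ_{i<k} w²∕(1+ciw)² ≤ w² + w∕c` (the `i = 0` term is `w²`; for `i = j+1`, `w²∕(1+c(j+1)w)² ≤ (w∕c)(1∕(1+cjw) − 1∕(1+c(j+1)w))` and the
differences telescope to `≤ w∕c`). [folklore] -/
theorem sum_sq_div_sq_le {w : ℝ} (hc : 0 < c) (hw : 0 ≤ w) (k : ℕ) :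
    ∑ i ∈ range k, w ^ 2 / (1 + c * i * w) ^ 2 ≤ w ^ 2 + w / c := by
  rcases k with _ | k
  · simp only [Finset.sum_range_zero]; positivity
  rw [Finset.sum_range_succ']
  simp only [Nat.cast_zero, mul_zero, zero_mul, add_zero, one_pow, div_one, Nat.cast_succ]
  have hterm : ∀ j : ℕ, w ^ 2 / (1 + c * ((j : ℝ) + 1) * w) ^ 2 ≤ (w / c) * (1 / (1 + c * j * w) - 1 / (1 + c * ((j : ℝ) + 1) * w)) := by
    intro j
    have hj : (0 : ℝ) ≤ j := Nat.cast_nonneg j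
    have hD0 : 0 < 1 + c * j * w := by have := mul_nonneg (mul_nonneg hc.le hj) hw; linarith
    have hD1 : 0 < 1 + c * ((j : ℝ) + 1) * w := by have := mul_nonneg (mul_nonneg hc.le (by linarith : (0:ℝ) ≤ j + 1)) hw; linarith
    have e : (w / c) * (1 / (1 + c * j * w) - 1 / (1 + c * ((j : ℝ) + 1) * w)) = w ^ 2 / ((1 + c * j * w) * (1 + c * ((j : ℝ) + 1) * w)) := by
      field_simp
      ring
    rw [e]
    have hle : (1 + c * j * w) * (1 + c * ((j : ℝ) + 1) * w) ≤ (1 + c * ((j : ℝ) + 1) * w) ^ 2 := by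
      have : 1 + c * j * w ≤ 1 + c * ((j : ℝ) + 1) * w := by nlinarith [mul_nonneg hc.le hw]
      nlinarith [hD1.le]
    exact div_le_div_of_nonneg_left (sq_nonneg w) (mul_pos hD0 hD1) hle
  have hsum : ∑ j ∈ range k, w ^ 2 / (1 + c * ((j : ℝ) + 1) * w) ^ 2
      ≤ (w / c) * ∑ j ∈ range k, (1 / (1 + c * j * w) - 1 / (1 + c * ((j : ℝ) + 1) * w)) := by
    rw [Finset.mul_sum]
    exact Finset.sum_le_sum fun j _ => hterm j
  have htel : ∑ j ∈ range k, (1 / (1 + c * j * w) - 1 / (1 + c * ((j : ℝ) + 1) * w)) = 1 / (1 + c * (0 : ℕ) * w) - 1 / (1 + c * (k : ℕ) * w) := by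
    have := Finset.sum_range_sub' (fun j : ℕ => 1 / (1 + c * (j : ℝ) * w)) k
    simpa [Nat.cast_succ] using this
  have hk0 : 0 ≤ 1 / (1 + c * (k : ℝ) * w) := by
    have := mul_nonneg (mul_nonneg hc.le (Nat.cast_nonneg k)) hw
    positivity
  have htel' : ∑ j ∈ range k, (1 / (1 + c * j * w) - 1 / (1 + c * ((j : ℝ) + 1) * w)) ≤ 1 := by
    rw [htel]; simp only [Nat.cast_zero, mul_zero, zero_mul, add_zero, div_one]; linarith
  have hwc : 0 ≤ w / c := div_nonneg hw hc.le
  calc ∑ j ∈ range k, w ^ 2 / (1 + c * ((j : ℝ) + 1) * w) ^ 2 + w ^ 2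
      ≤ (w / c) * 1 + w ^ 2 := by nlinarith [mul_le_mul_of_nonneg_left htel' hwc]
    _ = w ^ 2 + w / c := by ring

/-! ## §2 The bare discrepancy and the two-run shift of the toy -/

/-- **THE BARE DISCREPANCY OF AN IR-MATCHED TOY PAIR IS BOUNDED**: with `α > 0`, `c > 0`, `β₀ ≥ 0`, both runs in `]0,γ]` and the window `α(γ⁴ + γ²∕c) ≤ ½`:
`|1∕(hs 0)² − 1∕(gs 0)²| ≤ 2(β₀ + αγ²)` (from `inv_sq_bare_sub_eq_of_pin`: the `F_k` term is `≤ β₀ + αγ²`, and the history sum is `≤ α·Δ·(γ⁴ + γ²∕c) ≤ Δ∕2`, absorbed). [folklore] -/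
theorem abs_inv_sq_bare_sub_le (hβ : ∀ (k : ℕ) (p : Fin (k + 1) → ℝ), β k p = β₀ + α * (p 0) ^ 2 / (1 + c * k * (p 0) ^ 2))
    (hα : 0 < α) (hc : 0 < c) (hβ₀ : 0 ≤ β₀) (hγ : 0 < γ) (hwin : α * (γ ^ 4 + γ ^ 2 / c) ≤ 1 / 2)
    {k : ℕ} {gs hs : ℕ → ℝ} (hg : RGEqH (k + 1) β gs) (hIg : Step.InInterval γ (k + 1) gs) (hh : RGEqH k β hs) (hIh : Step.InInterval γ k hs)
    (hend : hs k = gs (k + 1)) :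
    |1 / hs 0 ^ 2 - 1 / gs 0 ^ 2| ≤ 2 * (β₀ + α * γ ^ 2) := by
  have hxB := hIg 0 (Nat.zero_le _)
  have hxA := hIh 0 (Nat.zero_le _)
  set uB : ℝ := (gs 0) ^ 2 with huB
  set uA : ℝ := (hs 0) ^ 2 with huA
  have huB0 : 0 < uB := by rw [huB]; exact pow_pos hxB.1 2
  have huA0 : 0 < uA := by rw [huA]; exact pow_pos hxA.1 2
  have huBγ : uB ≤ γ ^ 2 := by rw [huB]; nlinarith [hxB.1, hxB.2]
  have huAγ : uA ≤ γ ^ 2 := by rw [huA]; nlinarith [hxA.1, hxA.2]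
  set Δ : ℝ := 1 / hs 0 ^ 2 - 1 / gs 0 ^ 2 with hΔ
  -- the difference of bare couplings in terms of Δ
  have hdiff : uB - uA = uA * uB * Δ := by
    rw [hΔ]
    have e1 : (hs 0) ^ 2 = uA := rfl
    have e2 : (gs 0) ^ 2 = uB := rfl
    rw [e1, e2]
    field_simp
  -- each history term
  have hFi : ∀ i : ℕ, (β₀ + α * uB / (1 + c * i * uB)) - (β₀ + α * uA / (1 + c * i * uA)) = α * (uA * uB * Δ) / ((1 + c * i * uB) * (1 + c * i * uA)) := by
    intro i
    have h1 : 0 < 1 + c * i * uB := by positivity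
    have h2 : 0 < 1 + c * i * uA := by positivity
    rw [← hdiff]
    field_simp
    ring
  set w : ℝ := max uA uB with hw
  have hw0 : 0 ≤ w := le_max_of_le_left huA0.le
  have hwγ : w ≤ γ ^ 2 := max_le huAγ huBγ
  have habsFi : ∀ i : ℕ, |(β₀ + α * uB / (1 + c * i * uB)) - (β₀ + α * uA / (1 + c * i * uA))| ≤ α * |Δ| * (w ^ 2 / (1 + c * i * w) ^ 2) := by
    intro i
    have hi : (0 : ℝ) ≤ c * i := by positivity
    have h1 : 0 < 1 + c * i * uB := by positivity
    have h2 : 0 < 1 + c * i * uA := by positivity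
    rw [hFi i, abs_div, abs_of_pos (mul_pos h1 h2)]
    have hnum : |α * (uA * uB * Δ)| = α * (uA * uB) * |Δ| := by
      rw [abs_mul, abs_mul, abs_of_pos hα, abs_of_pos (mul_pos huA0 huB0)]; ring
    rw [hnum]
    -- uA/(1+ciuA) ≤ w/(1+ciw), uB/(1+ciuB) ≤ w/(1+ciw)
    have hmA : uA / (1 + c * i * uA) ≤ w / (1 + c * i * w) := transportFactor_mono hi huA0.le (le_max_left _ _)
    have hmB : uB / (1 + c * i * uB) ≤ w / (1 + c * i * w) := transportFactor_mono hi huB0.le (le_max_right _ _)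
    have hA0 : 0 ≤ uA / (1 + c * i * uA) := by positivity
    have hB0 : 0 ≤ uB / (1 + c * i * uB) := by positivity
    have hprod : uA / (1 + c * i * uA) * (uB / (1 + c * i * uB)) ≤ w / (1 + c * i * w) * (w / (1 + c * i * w)) :=
      mul_le_mul hmA hmB hB0 (hA0.trans hmA)
    have e : α * (uA * uB) * |Δ| / ((1 + c * i * uB) * (1 + c * i * uA)) = α * |Δ| * (uA / (1 + c * i * uA) * (uB / (1 + c * i * uB))) := by
      field_simp
    have e2 : w / (1 + c * i * w) * (w / (1 + c * i * w)) = w ^ 2 / (1 + c * i * w) ^ 2 := by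
      rw [div_mul_div_comm, ← pow_two, ← pow_two]
    rw [e, ← e2]
    exact mul_le_mul_of_nonneg_left hprod (by positivity)
  -- the F_k(x_B) term
  have hFk : 0 ≤ β₀ + α * uB / (1 + c * k * uB) ∧ β₀ + α * uB / (1 + c * k * uB) ≤ β₀ + α * γ ^ 2 := by
    have hnn : 0 ≤ c * k * uB := by positivity
    have hden : 1 ≤ 1 + c * k * uB := by linarith
    have h1 : α * uB / (1 + c * k * uB) ≤ α * uB := div_le_self (by positivity) hden
    refine ⟨by positivity, ?_⟩
    nlinarith
  -- assemble
  have hid := inv_sq_bare_sub_eq_of_pin hβ hg hh hend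
  have e1 : (gs 0) ^ 2 = uB := rfl
  have e2 : (hs 0) ^ 2 = uA := rfl
  simp only [e1, e2] at hid
  have hsum : |∑ i ∈ range k, ((β₀ + α * uB / (1 + c * i * uB)) - (β₀ + α * uA / (1 + c * i * uA)))| ≤ α * |Δ| * (w ^ 2 + w / c) := by
    calc |∑ i ∈ range k, ((β₀ + α * uB / (1 + c * i * uB)) - (β₀ + α * uA / (1 + c * i * uA)))|
        ≤ ∑ i ∈ range k, |(β₀ + α * uB / (1 + c * i * uB)) - (β₀ + α * uA / (1 + c * i * uA))| := Finset.abs_sum_le_sum_abs _ _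
      _ ≤ ∑ i ∈ range k, α * |Δ| * (w ^ 2 / (1 + c * i * w) ^ 2) := Finset.sum_le_sum fun i _ => habsFi i
      _ = α * |Δ| * ∑ i ∈ range k, w ^ 2 / (1 + c * i * w) ^ 2 := by rw [Finset.mul_sum]
      _ ≤ α * |Δ| * (w ^ 2 + w / c) := mul_le_mul_of_nonneg_left (sum_sq_div_sq_le hc hw0 k) (by positivity)
  have hwsum : w ^ 2 + w / c ≤ γ ^ 4 + γ ^ 2 / c := by
    have : w ^ 2 ≤ (γ ^ 2) ^ 2 := pow_le_pow_left₀ hw0 hwγ 2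
    have h2 : w / c ≤ γ ^ 2 / c := div_le_div_of_nonneg_right hwγ hc.le
    nlinarith
  have hΔabs : |Δ| ≤ (β₀ + α * γ ^ 2) + |Δ| / 2 := by
    have h1 : |Δ| ≤ |β₀ + α * uB / (1 + c * k * uB)| + |∑ i ∈ range k, ((β₀ + α * uB / (1 + c * i * uB)) - (β₀ + α * uA / (1 + c * i * uA)))| := by
      rw [hΔ, hid]
      exact (abs_sub _ _).trans (by rw [abs_neg])
    have h2 : |β₀ + α * uB / (1 + c * k * uB)| ≤ β₀ + α * γ ^ 2 := by rw [abs_of_nonneg hFk.1]; exact hFk.2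
    have h3 : α * |Δ| * (w ^ 2 + w / c) ≤ |Δ| / 2 := by
      have := mul_le_mul_of_nonneg_left (hwsum.trans' le_rfl) (by positivity : 0 ≤ α * |Δ|)
      have h4 : α * |Δ| * (γ ^ 4 + γ ^ 2 / c) = |Δ| * (α * (γ ^ 4 + γ ^ 2 / c)) := by ring
      have h5 : |Δ| * (α * (γ ^ 4 + γ ^ 2 / c)) ≤ |Δ| * (1 / 2) := mul_le_mul_of_nonneg_left hwin (abs_nonneg _)
      linarith
    linarith [hsum]
  rw [hΔ] at hΔabs ⊢
  linarith

/-- ★ **THE TOY SATISFIES FILE 6's IR-MATCHED TWO-RUN LETTER WITH A SUMMABLE POLYNOMIAL MODULUS**: `α > 0`, `c > 0`, `β₀ ≥ 0`, `γ > 0`, window `α(γ⁴ + γ²∕c) ≤ ½` ⟹ for every IR-matched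
pair of in-window toy runs, `|β_{k+1}(gs-prefix) − β_k(hs-prefix)| ≤ α(2(β₀+αγ²) + c)∕(m²(k+1)²)`, `m := min c (1∕γ²)` (exact shift `toyTwoRunShift`-algebra + `abs_inv_sq_bare_sub_le` + the
denominators `1∕u_B + c(k+1) ≥ m(k+1)`, `1∕u_A + ck ≥ m(k+1)`).  Compare FILE 7 ∕ FILE 8: NO box letter for this family, run-window modulus `≍ 1∕k²` too. [cite: Balaban1987RG1, (0.20) p.256, Thm 2 p.259 and (1.20)–(1.22) p.264] -/
theorem twoRunShift_toy (hβ : ∀ (k : ℕ) (p : Fin (k + 1) → ℝ), β k p = β₀ + α * (p 0) ^ 2 / (1 + c * k * (p 0) ^ 2))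
    (hα : 0 < α) (hc : 0 < c) (hβ₀ : 0 ≤ β₀) (hγ : 0 < γ) (hwin : α * (γ ^ 4 + γ ^ 2 / c) ≤ 1 / 2) :
    ∀ (k : ℕ) (gs hs : ℕ → ℝ), RGEqH (k + 1) β gs → Step.InInterval γ (k + 1) gs → RGEqH k β hs → Step.InInterval γ k hs →
      hs k = gs (k + 1) → |β (k + 1) (prefixOf gs (k + 1)) - β k (prefixOf hs k)| ≤
        α * (2 * (β₀ + α * γ ^ 2) + c) / ((min c (1 / γ ^ 2)) ^ 2 * ((k : ℝ) + 1) ^ 2) := by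
  intro k gs hs hg hIg hh hIh hend
  have hxB := hIg 0 (Nat.zero_le _)
  have hxA := hIh 0 (Nat.zero_le _)
  have hΔ := abs_inv_sq_bare_sub_le hβ hα hc hβ₀ hγ hwin hg hIg hh hIh hend
  set uB : ℝ := (gs 0) ^ 2 with huB
  set uA : ℝ := (hs 0) ^ 2 with huA
  have huB0 : 0 < uB := by rw [huB]; exact pow_pos hxB.1 2
  have huA0 : 0 < uA := by rw [huA]; exact pow_pos hxA.1 2
  set m : ℝ := min c (1 / γ ^ 2) with hm
  have hm0 : 0 < m := lt_min hc (by positivity)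
  have hmc : m ≤ c := min_le_left _ _
  have hmγ : m ≤ 1 / γ ^ 2 := min_le_right _ _
  have hinvB : 1 / γ ^ 2 ≤ 1 / uB := one_div_le_one_div_of_le huB0 (by rw [huB]; nlinarith [hxB.1, hxB.2])
  have hinvA : 1 / γ ^ 2 ≤ 1 / uA := one_div_le_one_div_of_le huA0 (by rw [huA]; nlinarith [hxA.1, hxA.2])
  have hk0 : (0 : ℝ) ≤ k := Nat.cast_nonneg k
  -- the shift, exactly
  rw [hβ (k + 1), hβ k]
  simp only [prefixOf_apply, Fin.val_zero, Nat.cast_succ]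
  have e1 : (gs 0) ^ 2 = uB := rfl
  have e2 : (hs 0) ^ 2 = uA := rfl
  rw [e1, e2]
  have hDB : 0 < 1 / uB + c * ((k : ℝ) + 1) := by positivity
  have hDA : 0 < 1 / uA + c * (k : ℝ) := by positivity
  have eB : α * uB / (1 + c * ((k : ℝ) + 1) * uB) = α / (1 / uB + c * ((k : ℝ) + 1)) := by
    field_simp
  have eA : α * uA / (1 + c * (k : ℝ) * uA) = α / (1 / uA + c * (k : ℝ)) := by
    field_simp
  rw [eB, eA]
  have ediff : β₀ + α / (1 / uB + c * ((k : ℝ) + 1)) - (β₀ + α / (1 / uA + c * (k : ℝ)))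
      = α * ((1 / uA - 1 / uB) - c) / ((1 / uB + c * ((k : ℝ) + 1)) * (1 / uA + c * (k : ℝ))) := by
    field_simp
    ring
  rw [ediff, abs_div, abs_of_pos (mul_pos hDB hDA), abs_mul, abs_of_pos hα]
  -- numerator and denominator bounds
  have hnum : |(1 / uA - 1 / uB) - c| ≤ 2 * (β₀ + α * γ ^ 2) + c := by
    have : |(1 / uA - 1 / uB) - c| ≤ |1 / uA - 1 / uB| + |c| := abs_sub _ _
    rw [abs_of_pos hc] at this
    have hΔ' : |1 / uA - 1 / uB| ≤ 2 * (β₀ + α * γ ^ 2) := by simpa [huA, huB] using hΔ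
    linarith
  have hden : m ^ 2 * ((k : ℝ) + 1) ^ 2 ≤ (1 / uB + c * ((k : ℝ) + 1)) * (1 / uA + c * (k : ℝ)) := by
    have h1 : m * ((k : ℝ) + 1) ≤ 1 / uB + c * ((k : ℝ) + 1) := by
      have : m * ((k : ℝ) + 1) ≤ c * ((k : ℝ) + 1) := mul_le_mul_of_nonneg_right hmc (by linarith)
      linarith [lt_of_lt_of_le (by positivity : (0 : ℝ) < 1 / γ ^ 2) hinvB]
    have h2 : m * ((k : ℝ) + 1) ≤ 1 / uA + c * (k : ℝ) := by
      have : m * (k : ℝ) ≤ c * (k : ℝ) := mul_le_mul_of_nonneg_right hmc hk0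
      linarith
    have := mul_le_mul h1 h2 (by positivity) hDB.le
    nlinarith
  calc α * |(1 / uA - 1 / uB) - c| / ((1 / uB + c * ((k : ℝ) + 1)) * (1 / uA + c * (k : ℝ)))
      ≤ α * (2 * (β₀ + α * γ ^ 2) + c) / ((1 / uB + c * ((k : ℝ) + 1)) * (1 / uA + c * (k : ℝ))) :=
        div_le_div_of_nonneg_right (mul_le_mul_of_nonneg_left hnum hα.le) (by positivity)
    _ ≤ α * (2 * (β₀ + α * γ ^ 2) + c) / (m ^ 2 * ((k : ℝ) + 1) ^ 2) :=
        div_le_div_of_nonneg_left (by positivity) (by positivity) hden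

/-- ★★ **EVERY RUN-WISE CONSTANT REMAINDER FOR THE TOY THROUGH FILE 6's TWO-RUN LEVER** (`exists_runConstRemainder_of_twoRunShift_cornerStep_scaleAnchor_endRuns` BY NAME: anchor
`scaleAnchor_toy`, summable (TR) `twoRunShift_toy` ∕ `summable_toyModulus`, corner step 0, (ER) `endRuns_toy`): `∀ s > 0 ∃ γ_s ∈ ]0,γ]`, `RunConstRemainder β (fun _ ↦ β₀) s γ_s` — the same
conclusion as FILE 8's ★★, now certifying that FILE 6's lever too has a NON-FLAT first-entry-only inhabitant.  A toy; nothing of Bałaban. [cite: Balaban1987RG1, Thm 2 p.259 and (2.12)–(2.14) p.268] -/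
theorem exists_runConstRemainder_toy_twoRun (hβ : ∀ (k : ℕ) (p : Fin (k + 1) → ℝ), β k p = β₀ + α * (p 0) ^ 2 / (1 + c * k * (p 0) ^ 2))
    (hα : 0 < α) (hc : 0 < c) (hβ₀ : 0 ≤ β₀) (hγ : 0 < γ) (hwin : α * (γ ^ 4 + γ ^ 2 / c) ≤ 1 / 2) {s : ℝ} (hs : 0 < s) :
    ∃ γs : ℝ, 0 < γs ∧ γs ≤ γ ∧ RunConstRemainder β (fun _ => β₀) s γs :=
  exists_runConstRemainder_of_twoRunShift_cornerStep_scaleAnchor_endRuns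
    (a := fun k => α * (2 * (β₀ + α * γ ^ 2) + c) / ((min c (1 / γ ^ 2)) ^ 2 * ((k : ℝ) + 1) ^ 2)) (e := fun _ => 0)
    hγ (scaleAnchor_toy hβ hα hc.le) (twoRunShift_toy hβ hα hc hβ₀ hγ hwin) (summable_toyModulus _ _)
    (fun _ => by simp) summable_zero (endRuns_toy hβ hα hc.le hβ₀) hs

end Summit.QuantumFields.YangMills.BalabanUVNodes.N17TwoRunShiftTransportToy

end
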